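import Literature.AlgebraicGeometry.HodgeTheory.CompleteIntersectionHodgeLocusCodim
import Summits.HodgeConjecture.HodgeConjecture.Theorems.CyclicUnitaryPowersEigenHodgeNumbersAffine

/-!
# The route's coefficient lists `cube p` are Hilbert functions of complete intersections
# (route `CyclicUnitaryPowers`, item stmt-HodgeConjecture-19544; helper)

Helper file for the K1 line `unitary-reflection-zariski` (v4) of crux `VeryGeneralDeckCommutatorsInHg`
of route `route-HodgeConjecture-CyclicUnitaryPowers` (cell `hodge-nonav`); landed
`--supports stmt-HodgeConjecture-19544` as a helper. Prover seat `hodge-nonav-prover-A` (g0), 2026-08-27.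
Sorry-free, no definition, no named fact. Consumed by `Theorems/CyclicUnitaryPowersDeckHodgeOfCarlsonToledo`
(the seam `stub_cyclicDeckHodge ⟸` Carlson–Toledo's two facts).

The route `CyclicUnitaryPowers` encodes the eigen-Hodge numbers of the `p`-cyclic planes by the
computable list `cube p = (1,…,1)^{*3}` (`p − 1` ones, Cauchy products `pmul`, `ehn p j q = (cube p)` at
`(q+1)p − 3 − j`). This file identifies that list with the Hilbert function of an Artinian complete
intersection of type `(p−1, p−1, p−1)` — the tree's computable `Kloosterman2023.ciHilbert` — and hence
with the Hilbert function of the Jacobian ring of a ternary form of degree `p` with isolated singularity: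

* `foldl_pmul_replicate_getD_eq_ciHilbert` — for all `c n m`: the `m`-th entry of the `n`-fold `pmul`-power
  of the all-ones list of length `c` is `ciHilbert [c,…,c] m` (induction on `n`: one Cauchy factor is the
  recursion `ciHilbert_cons`, after the reindexing `i ↦ m − i`; the landed `cauchy_getD` reads the entries);
* `hilbert_jacobianIdeal_ternary_eq_ciHilbert` — `dim S^a − dim J_f^a = ciHilbert [p−1,p−1,p−1] a` for a
  ternary form `f` of degree `p ≥ 2` with a power of every variable in `J_f` (Macaulay; the tree's
  `hilbert_jacobianIdeal_eq_card` + `card_filter_finsuppAntidiag_eq_ciHilbert`).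

## References

* [Kloosterman2023] R. Kloosterman, Variational Hodge conjecture for complete intersections on
  hypersurfaces in projective space, Rend. Sem. Mat. Univ. Padova 148 (2023), §2 eq. (1).
* [Movasati2016Periods] H. Movasati, Why should one compute periods of algebraic cycles?,
  arXiv:1602.06607, Definition 1.
-/

noncomputable section

namespace Summit.HodgeConjecture.HodgeConjecture.Theorems.CyclicUnitaryPowersCubeHilbert

open Literature.AlgebraicGeometry.Motives Literature.AlgebraicGeometry.HodgeTheory
open Literature.AlgebraicGeometry.Kloosterman2023 (ciHilbert ciHilbert_cons ciHilbert_nil)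
open Literature.RingTheory.MvPolynomial (idealDegree)
open Summit.HodgeConjecture.HodgeConjecture.Theorems.CyclicUnitaryPowersEigenHodgeNumbersAffine
  (cauchy_getD getD_replicate_one getD_singleton_one list_sum_map_range_eq)
open MvPolynomial

/-! ### §1 The coefficient list `cube p` of the route is the Hilbert function `ciHilbert [p−1,p−1,p−1]` -/

/-- Reindexing `i ↦ m − i`: `Σ_{i ≤ m} H(i)·[m − i < c] = Σ_{j < c} [j ≤ m]·H(m − j)`. [folklore] -/
theorem sum_range_mul_indicator_reflect (H : ℕ → ℕ) (c m : ℕ) :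
    ∑ i ∈ Finset.range (m + 1), H i * (if m - i < c then 1 else 0) =
      ∑ j ∈ Finset.range c, (if j ≤ m then H (m - j) else 0) := by
  rw [← Finset.sum_filter_add_sum_filter_not (Finset.range (m + 1)) (fun i ↦ m - i < c),
    ← Finset.sum_filter_add_sum_filter_not (Finset.range c) (fun j ↦ j ≤ m)]
  have h1 : ∑ i ∈ (Finset.range (m + 1)).filter (fun i ↦ ¬ m - i < c),
      H i * (if m - i < c then 1 else 0) = 0 :=
    Finset.sum_eq_zero fun i hi ↦ by rw [if_neg (Finset.mem_filter.1 hi).2, mul_zero]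
  have h2 : ∑ j ∈ (Finset.range c).filter (fun j ↦ ¬ j ≤ m), (if j ≤ m then H (m - j) else 0) = 0 :=
    Finset.sum_eq_zero fun j hj ↦ by rw [if_neg (Finset.mem_filter.1 hj).2]
  rw [h1, h2, add_zero, add_zero]
  refine Finset.sum_nbij' (fun i ↦ m - i) (fun j ↦ m - j) (fun i hi ↦ ?_) (fun j hj ↦ ?_)
    (fun i hi ↦ ?_) (fun j hj ↦ ?_) (fun i hi ↦ ?_)
  · simp only [Finset.mem_filter, Finset.mem_range] at hi ⊢; omega
  · simp only [Finset.mem_filter, Finset.mem_range] at hj ⊢; omega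
  · simp only [Finset.mem_filter, Finset.mem_range] at hi; omega
  · simp only [Finset.mem_filter, Finset.mem_range] at hj; omega
  · simp only [Finset.mem_filter, Finset.mem_range] at hi
    rw [if_pos hi.2, mul_one, if_pos (Nat.sub_le m i), Nat.sub_sub_self (by omega)]

/-- **The route's coefficient lists are Hilbert functions of monomial complete intersections**: the
`n`-fold Cauchy product of the all-ones list of length `c` (coefficients of `(1 + t + ⋯ + t^{c−1})ⁿ`),
computed by the route's `pmul`/`List.foldl`, has `m`-th entry `ciHilbert [c, …, c] m` (`n` entries),
the number of monomials of degree `m` in `n` variables with all exponents `< c`.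
[cite: Kloosterman2023, §2 eq. (1)] -/
theorem foldl_pmul_replicate_getD_eq_ciHilbert (c n m : ℕ) :
    ((List.replicate n (List.replicate c 1)).foldl
        (fun a b : List ℕ => (List.range (a.length + b.length - 1)).map fun k =>
          ((List.range (k + 1)).map fun i => a.getD i 0 * b.getD (k - i) 0).sum) [1]).getD m 0 =
      ciHilbert (List.replicate n c) m := by
  induction n generalizing m with
  | zero => rw [List.replicate_zero, List.foldl_nil, getD_singleton_one, List.replicate_zero, ciHilbert_nil]
  | succ n ih =>
    conv_lhs => rw [List.replicate_succ', List.foldl_append, List.foldl_cons, List.foldl_nil, cauchy_getD]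
    conv_rhs => rw [List.replicate_succ, ciHilbert_cons, list_sum_map_range_eq]
    simp_rw [getD_replicate_one, ih]
    exact sum_range_mul_indicator_reflect _ c m

/-! ### §2 The Hilbert function of the Jacobian ring of a ternary form with isolated singularity -/

/-- **`dim_ℂ R_f^a = ciHilbert [p−1, p−1, p−1] a`** for a ternary form `f` of degree `p ≥ 2` with a
power of every variable in its Jacobian ideal (Macaulay; the tree's `hilbert_jacobianIdeal_eq_card` and
`card_filter_finsuppAntidiag_eq_ciHilbert`). [cite: Movasati2016Periods, Definition 1]
[cite: Kloosterman2023, §2 eq. (1)] -/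
theorem hilbert_jacobianIdeal_ternary_eq_ciHilbert {p : ℕ} {f : MvPolynomial (Fin 3) ℂ}
    (hf : f.IsHomogeneous p) (hp : 2 ≤ p) {M : ℕ}
    (hXM : ∀ i, (X i : MvPolynomial (Fin 3) ℂ) ^ M ∈ UniversalHypersurface.jacobianIdeal f) (a : ℕ) :
    Module.finrank ℂ ↥(MvPolynomial.homogeneousSubmodule (Fin 3) ℂ a) -
        Module.finrank ℂ ↥(idealDegree (UniversalHypersurface.jacobianIdeal f) a) =
      ciHilbert (List.replicate 3 (p - 1)) a := by
  rw [hilbert_jacobianIdeal_eq_card hf hp hXM a, ← List.ofFn_const,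
    ← card_filter_finsuppAntidiag_eq_ciHilbert (fun _ : Fin 3 => p - 1) (fun _ => by omega) a,
    show p - 1 - 1 = p - 2 by omega]

end Summit.HodgeConjecture.HodgeConjecture.Theorems.CyclicUnitaryPowersCubeHilbert

end
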